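import Summits.NavierStokesRegularity.FluidComputer.BlockReachProbe

/-!
# The instantaneous interface cannot drive a reach certificate

Block (wavelet-pair) line of the `pub-fluidc` cell, bp3 gen 35, ASSEMBLY §2g.9(r). HONEST FRAMING:
low prior, high value-of-information experiment on Tao's machine paradigm; NOT a claim that NS
blows up. Everything here is [folklore] mathematics ABOUT the re-typed local layer
`OpenReachBound 𝒟 P F U ε` (bp3 ASK 95) and bp1's reach certificates
(`Literature/Analysis/FluidPDE/FluidComputer/ReachCertificate.lean`); no residue is claimed.

THE ASSEMBLY IT CLOSES. The re-typed assembly of the block line (ASK 95,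
`OpenReachBound.toReachCircuit`) takes TWO inputs on the same open working region `U`: an inhabited
instantaneous residue `OpenReachBound 𝒟 P F U ε` (the readout law `ε`-close to `F`, junk Dini
rate) and a robust reach–avoid certificate `ReachCertificate F U ε 1 (AinO P) (AoutO P)` for the
design field `F` (every curve from an admissible input, in `U`, with right derivative `ε`-close to
`F`, stays in its tube `⊆ U` and visits the outputs `AoutO P` within the cycle). The probe no-go
(`BlockReachProbe.lean`, ASK 100) pins `F` on `U` to PURE VISCOUS DECAY,
`‖F p - unit(1) • (-Λ_1 A, -Λ_2 B)‖ ≤ ε` (`OpenReachBound.norm_sub_damping_le`), as soon as `U`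
contains an input ray and an output ray. This file draws the conclusion for the assembly:

* `cert_forall_mem`, `cert_exists_mem` (§1, pure real analysis, any normed space): a continuous
  curve from an admissible input whose right derivative is `ε`-close to `F` WHEREVER THE CURVE IS
  IN `U` never leaves `U` during the cycle (continuation through the infimum of the exit times and
  the AVOID clause `Tube ⊆ U`) and therefore visits `Aout` (the REACH clause).
* `OpenReachBound.no_certificate` (§2): with both rays in the open region `U`, the decay curve
  `σ ↦ (aLo e^{-unit(1) Λ_1 σ}, 0)` from the clean admissible input `(aLo, 0) ∈ AinO P` is such a
  curve (its derivative IS the pure damping field, `ε`-close to `F` by the probe no-go); its output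
  amplitude is identically `0 < aLo`, so it never visits `AoutO P = [-σsp, σsp] × [aLo, ∞)`:
  CONTRADICTION. Hence **no design field `F` whatsoever admits, on such a region, both an
  inhabited instantaneous residue and a reach certificate from `AinO P` to `AoutO P`**;
  `not_reachCertificate_loadedRegion` / `isEmpty_reachCertificate_loadedRegion`: in particular on
  the loaded region `{a² + ηb² > 2}` (`η ≥ 0`), for every `F`, `ε`.

HONEST READING. This is the END of the instantaneous re-typing (§2g.9(m)) as an assembly route, for
every design at once: its two hypotheses are jointly unsatisfiable on the loaded region (and on any
open region containing an input and an output ray). It is a statement about the TYPING — law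
demanded of all `H¹⁰_df` data under an absolute junk ceiling, absolute tolerance, amplitude-
unbounded region — not about Navier–Stokes and not about Tao's programme; the whole-tick residue
`OpenIdeaBound` (ASK 91) is untouched. Nothing is discharged; not evidence about NS in either
direction.
-/

noncomputable section

open MeasureTheory Set Filter Topology Metric
open scoped ENNReal NNReal

namespace Summit.NavierStokesRegularity.FluidComputer

open Literature.Analysis.FluidPDE Literature.Analysis.FluidPDE.Tao2016
open Literature.Analysis.FluidPDE.FluidComputer
open Summit.NavierStokesRegularity.NavierStokesRegularity.Theorems.FluidComputer

namespace BlockDesign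

/-! ### §1. Certified curves do not leave the working region, hence visit the outputs -/

section Continuation

variable {O : Type*} [NormedAddCommGroup O] [NormedSpace ℝ O]
variable {F : O → O} {U : Set O} {ε τc : ℝ} {Ain Aout : Set O}

/-- **Certified curves cannot leave the open working region.** If `x` is a continuous curve from
`p ∈ Ain` whose right derivative is `ε`-close to `F (x σ)` at every `σ ∈ [0, τc)` AT WHICH
`x σ ∈ U`, then `x σ ∈ U` for all `σ ∈ [0, τc]`: at the infimum `σ₀` of the exit times the curve is
in `U` on `[0, σ₀)`, so the certificate puts `x σ₀` in `Tube p σ₀ ⊆ U`. [folklore] -/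
theorem cert_forall_mem (c : ReachCertificate F U ε τc Ain Aout) (hU : IsOpen U) {p : O}
    (hp : p ∈ Ain) {x : ℝ → O} (hx0 : x 0 = p) (hxc : Continuous x)
    (hW : ∀ σ ∈ Ico 0 τc, x σ ∈ U →
      ∃ W : O, HasDerivWithinAt x W (Ici σ) σ ∧ ‖W - F (x σ)‖ ≤ ε) :
    ∀ σ ∈ Icc 0 τc, x σ ∈ U := by
  by_contra hcon
  push Not at hcon
  obtain ⟨σ₁, hσ₁, hσ₁U⟩ := hcon
  set B : Set ℝ := Icc 0 τc ∩ x ⁻¹' Uᶜ with hB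
  have hne : B.Nonempty := ⟨σ₁, hσ₁, hσ₁U⟩
  have hcl : IsClosed B := isClosed_Icc.inter (hU.isClosed_compl.preimage hxc)
  have hbd : BddBelow B := ⟨0, fun σ hσ => hσ.1.1⟩
  have h₀ : sInf B ∈ B := hcl.csInf_mem hne hbd
  have hin : ∀ s ∈ Ico 0 (sInf B), x s ∈ U := fun s hs => by
    by_contra hsU
    exact (not_le.2 hs.2) (csInf_le hbd ⟨⟨hs.1, hs.2.le.trans h₀.1.2⟩, hsU⟩)
  have hT := (c.cert p hp (sInf B) x h₀.1.1 h₀.1.2 hx0 hxc.continuousOn hin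
    (fun s hs => hW s ⟨hs.1, hs.2.trans_le h₀.1.2⟩ (hin s hs))).1
  exact h₀.2 (c.Tube_sub p hp (sInf B) h₀.1 hT)

/-- **… hence they visit the outputs within the cycle** (the REACH clause at `σT = τc`).
[folklore] -/
theorem cert_exists_mem (c : ReachCertificate F U ε τc Ain Aout) (hU : IsOpen U) (hτc : 0 ≤ τc)
    {p : O} (hp : p ∈ Ain) {x : ℝ → O} (hx0 : x 0 = p) (hxc : Continuous x)
    (hW : ∀ σ ∈ Ico 0 τc, x σ ∈ U →
      ∃ W : O, HasDerivWithinAt x W (Ici σ) σ ∧ ‖W - F (x σ)‖ ≤ ε) :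
    ∃ σ ∈ Icc 0 τc, x σ ∈ Aout := by
  have hall := cert_forall_mem c hU hp hx0 hxc hW
  exact (c.cert p hp τc x hτc le_rfl hx0 hxc.continuousOn
    (fun s hs => hall s (Ico_subset_Icc_self hs))
    (fun s hs => hW s hs (hall s (Ico_subset_Icc_self hs)))).2 rfl

end Continuation

/-! ### §2. The decay curve from a clean input never reaches the outputs -/

variable {𝒟 : CascadeWaveletData 1 1} {S : CascadeSpecs} {P : Params S}
variable {F : ℝ × ℝ → ℝ × ℝ} {U : Set (ℝ × ℝ)} {ε : ℝ}

/-- The decay curve `σ ↦ (a e^{-γσ}, 0)` has derivative `(-γ · a e^{-γσ}, 0)`. [folklore] -/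
theorem hasDerivAt_decayCurve (a γ σ : ℝ) :
    HasDerivAt (fun σ : ℝ => ((a * Real.exp (-(γ * σ)), (0 : ℝ)) : ℝ × ℝ))
      ((-(γ * (a * Real.exp (-(γ * σ)))), 0) : ℝ × ℝ) σ := by
  have h1 : HasDerivAt (fun σ : ℝ => a * Real.exp (-(γ * σ)))
      (a * (Real.exp (-(γ * σ)) * -(γ * 1))) σ :=
    ((Real.hasDerivAt_exp _).comp σ ((hasDerivAt_id σ).const_mul γ).neg).const_mul a
  refine (h1.prodMk (hasDerivAt_const σ (0 : ℝ))).congr_deriv ?_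
  ext <;> simp only [mul_one] ; ring

/-- The decay curve is continuous. [folklore] -/
theorem continuous_decayCurve (a γ : ℝ) :
    Continuous (fun σ : ℝ => ((a * Real.exp (-(γ * σ)), (0 : ℝ)) : ℝ × ℝ)) := by
  fun_prop

/-- **THE INSTANTANEOUS INTERFACE CANNOT DRIVE A REACH CERTIFICATE.** If the open working region
`U` contains an output ray `{(A₁, B) : B ≥ B₀}` and an input ray `{(A, B₁) : A ≥ A₀}`, then an
inhabited residue `OpenReachBound 𝒟 P F U ε` and a reach certificate
`ReachCertificate F U ε 1 (AinO P) (AoutO P)` cannot coexist, WHATEVER `F` AND `ε` ARE: the probe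
no-go pins `F` within `ε` of the pure damping field `unit(1) • (-Λ_1 A, -Λ_2 B)`
(`OpenReachBound.norm_sub_damping_le`), whose exact trajectory from the clean admissible input
`(aLo, 0)` is certified (§1) to visit `AoutO P`, i.e. to reach output amplitude `≥ aLo ≥ 1` — but
its output amplitude is identically `0`. [folklore] -/
theorem OpenReachBound.no_certificate (H : OpenReachBound 𝒟 P F U ε) {A₀ A₁ B₀ B₁ : ℝ}
    (hUout : ∀ B : ℝ, B₀ ≤ B → ((A₁, B) : ℝ × ℝ) ∈ U)
    (hUin : ∀ A : ℝ, A₀ ≤ A → ((A, B₁) : ℝ × ℝ) ∈ U) (hU : IsOpen U)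
    (c : ReachCertificate F U ε 1 (AinO P) (AoutO P)) : False := by
  have hp : ((P.aLo, (0 : ℝ)) : ℝ × ℝ) ∈ AinO P := mem_AinO_base (by linarith [P.δ_pos])
  have hγ := hasDerivAt_decayCurve P.aLo (H.unit (0 + 1) * viscRate 𝒟 (0 + 1))
  obtain ⟨σ, -, hσ⟩ := cert_exists_mem c hU zero_le_one hp
    (x := fun σ : ℝ =>
      ((P.aLo * Real.exp (-(H.unit (0 + 1) * viscRate 𝒟 (0 + 1) * σ)), (0 : ℝ)) : ℝ × ℝ))
    (by simp) (continuous_decayCurve _ _) (fun σ _ hσU => by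
      refine ⟨H.unit (0 + 1) •
          ((-(viscRate 𝒟 (0 + 1) *
              (P.aLo * Real.exp (-(H.unit (0 + 1) * viscRate 𝒟 (0 + 1) * σ)))),
            -(viscRate 𝒟 (0 + 1 + 1) * (0 : ℝ))) : ℝ × ℝ),
        (hγ σ).hasDerivWithinAt.congr_deriv ?_, ?_⟩
      · ext <;> simp only [Prod.smul_mk, smul_eq_mul, mul_zero, neg_zero] ; ring
      · rw [norm_sub_rev]
        exact H.norm_sub_damping_le hUout hUin 0 hσU)
  have h2 : P.aLo ≤ 0 := (Set.mem_prod.1 hσ).2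
  linarith [P.one_le_aLo]

/-- **On the loaded region, for EVERY design field**: `OpenReachBound 𝒟 P F (loadedRegion η) ε`
and `ReachCertificate F (loadedRegion η) ε 1 (AinO P) (AoutO P)` are jointly uninhabitable
(`η ≥ 0`; the rays `{(2, B)}` and `{(A, 0) : A ≥ 2}` lie in `{a² + ηb² > 2}`). The two hypotheses of
the re-typed assembly `OpenReachBound.toReachCircuit` (ASK 95) contradict each other there.
[folklore] -/
theorem not_reachCertificate_loadedRegion {η : ℝ} (hη : 0 ≤ η)
    (H : OpenReachBound 𝒟 P F (loadedRegion η) ε)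
    (c : ReachCertificate F (loadedRegion η) ε 1 (AinO P) (AoutO P)) : False :=
  H.no_certificate (A₀ := 2) (A₁ := 2) (B₀ := 0) (B₁ := 0)
    (fun B _ => mem_loadedRegion_of_two_le hη le_rfl B)
    (fun _ hA => mem_loadedRegion_of_two_le hη hA 0) (isOpen_loadedRegion η) c

/-- The same, as emptiness of the certificate type given an inhabited residue. [folklore] -/
theorem isEmpty_reachCertificate_loadedRegion {η : ℝ} (hη : 0 ≤ η)
    (H : OpenReachBound 𝒟 P F (loadedRegion η) ε) :
    IsEmpty (ReachCertificate F (loadedRegion η) ε 1 (AinO P) (AoutO P)) :=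
  ⟨fun c => not_reachCertificate_loadedRegion hη H c⟩

/-- … and as emptiness of the residue type given a certificate (the form in which a successor who
CAN certify a design field on the loaded region reads it: that design's instantaneous residue is
then refuted outright). [folklore] -/
theorem isEmpty_openReachBound_of_certificate {η : ℝ} (hη : 0 ≤ η)
    (c : ReachCertificate F (loadedRegion η) ε 1 (AinO P) (AoutO P)) :
    IsEmpty (OpenReachBound 𝒟 P F (loadedRegion η) ε) :=
  ⟨fun H => not_reachCertificate_loadedRegion hη H c⟩

end BlockDesign

end Summit.NavierStokesRegularity.FluidComputer

end
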